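import Literature.MathematicalPhysics.QuantumFieldTheory.Balaban1983to89.Node00.CanonicalTransportOfRecord
import Literature.MathematicalPhysics.QuantumFieldTheory.Balaban1983to89.B12EuclClause263

/-!
# NODE 00 — `Node00.EuclCovTransportOfRecord`: [Balaban1987RG1] (2.17) p. 269 ∕ p. 263 «the explicitly defined expressions … are invariant with respect to the
# Euclidean transformations» FOR THE TRANSFORM OF RECORD: the one-step kernel transport `transportOfRecord` is COVARIANT A.E. under the coarse translations,
# the centre reflections and the coordinate permutations (push-forward reading + a.e. uniqueness of renormalisation images), its maximal regular set is transported,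
# and the canonical-version transport `TcanOfRecord` (= `TβOfRecord₁₃`) is covariant AT EVERY POINT OF THE MAXIMAL REGULAR SET — porter PT-A-2 FILE E3 (row S5-0 (ii))

CITATION HEADER.  [I] = [Balaban1987RG1] (2.17) p. 269, (0.13) p. 254 («(Tρ)(V) = ∫ dU t(V,U) ρ(U)»), p. 263; [B7] = [Balaban1985Averaging] (10)–(13) p. 19 (push-forward
identity).  Companion of K0e FILE 6 `Node00/CanonicalTransportOfRecord` §4–§5 (the GAUGE case: `transportOfRecord_comp_gaugeAct_ae_eq`, `preimage_regSet_eq`,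
`canonVersion_comp_eqOn`, `TcanOfRecord_gaugeAct_of_mem_regSet`) — the SAME engine run for the lattice symmetries of (2.17), whose one new input is the two-level
push-forward lemma §1 (the symmetry acts on BOTH tori and intertwines the averaging: `B12EuclClause263.AveragingNestedCovariant` shape, certified for the averaging of
record by `BlockAveraging.blockAvg_translate ∕ _creflect ∕ _permute`).

WHAT IS PROVED.  §1 `isRT_comp_equivariant` — if `ρ′` is a renormalisation image of `ρ` along `avg` and `(Φf, Φc)` is a pair of measure-preserving bijections of the
fine ∕ coarse configuration spaces with `avg ∘ Φf = Φc ∘ avg`, then `ρ′ ∘ Φc` is a renormalisation image of `ρ ∘ Φf` ([B7] (10) transported).  §2 generic transport of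
versions along a measure-preserving continuous bijection for a PAIR of a.e.-related functions (`f ∘ Φ =ᵐ g`): `HasContVersionOn.pullback`, `regSet_eq_preimage_of_ae`,
`canonVersion_eqOn_comp_of_ae`.  §3 at the record, for each generator `r ∈ {τ_a, c_ρ, π}` of (2.17): `transportOfRecord_<r>_ae` (`T(ρ ∘ r_fine) =ᵐ (Tρ) ∘ r_coarse`),
`regSetOfRecord_<r>` (`regSet (ρ ∘ r_fine) = r_coarse ⁻¹' regSet ρ`), `TcanOfRecord_<r>_of_mem_regSet` (pointwise covariance on the maximal regular set), with the
continuity lemmas `continuous_translate ∕ _permute ∕ _creflect`.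
HONEST FRAMING.  Measure-theoretic bookkeeping; nothing of Bałaban's estimates asserted, ported or discharged; no `sorry`, standard axioms; YM mass gap (Clay) NOT proved.
-/

noncomputable section

open MeasureTheory Set Filter

namespace Literature.MathematicalPhysics.QuantumFieldTheory.Balaban1983to89.Node00

open T4Continuum B12RTGaugeInvariance254

/-! ## §1. The push-forward identity transported by an equivariant pair of measure-preserving bijections -/

section PushForward

variable {P : Params} {j : ℕ} {G : Type*} [GaugeGroup G] [MeasurableSpace G] [HaarData G]

/-- **[B7] (10) TRANSPORTED**: `ρ′` a renormalisation image of `ρ` along `avg`, `(Φf, Ψf)` and `(Φc, Ψc)` mutually inverse maps of the fine ∕ coarse configurations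
preserving the product Haar integrals, `Ψc` measurable, `avg ∘ Φf = Φc ∘ avg` ⟹ `ρ′ ∘ Φc` is a renormalisation image of `ρ ∘ Φf`.  (The gauge twin is
`B12RTGaugeInvariance254.isRT_comp_gaugeAct`.) [cite: Balaban1985Averaging, (10)–(13) p.19; Balaban1987RG1, (2.17) p.269] -/
theorem isRT_comp_equivariant {avg : GaugeField P j G → GaugeField P (j + 1) G} {ρ : Density P j G} {ρ' : Density P (j + 1) G}
    (h : IsRT avg ρ ρ') (Φf Ψf : GaugeField P j G → GaugeField P j G) (Φc Ψc : GaugeField P (j + 1) G → GaugeField P (j + 1) G)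
    (hIf : ∀ g : GaugeField P j G → ℝ, ∫ U, g (Φf U) ∂(fieldMeasure P j G) = ∫ U, g U ∂(fieldMeasure P j G))
    (hIc : ∀ g : GaugeField P (j + 1) G → ℝ, ∫ V, g (Φc V) ∂(fieldMeasure P (j + 1) G) = ∫ V, g V ∂(fieldMeasure P (j + 1) G))
    (hΨc : Measurable Ψc) (hΨΦc : ∀ V, Ψc (Φc V) = V) (hΨΦf : ∀ U, Ψf (Φf U) = U) (hΦΨf : ∀ U, Φf (Ψf U) = U)
    (hinter : ∀ U, avg (Φf U) = Φc (avg U)) :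
    IsRT avg (fun U => ρ (Φf U)) (fun V => ρ' (Φc V)) := by
  intro f hf hbd
  obtain ⟨C, hC⟩ := hbd
  have hΨavg : ∀ U, Ψc (avg U) = avg (Ψf U) := fun U => by
    have h1 := hinter (Ψf U)
    rw [hΦΨf] at h1
    rw [h1, hΨΦc]
  have key := h (fun V => f (Ψc V)) (hf.comp hΨc) ⟨C, fun V => hC _⟩
  calc ∫ V, ρ' (Φc V) * f V ∂(fieldMeasure P (j + 1) G)
      = ∫ V, ρ' (Φc V) * f (Ψc (Φc V)) ∂(fieldMeasure P (j + 1) G) := by simp_rw [hΨΦc]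
    _ = ∫ V, ρ' V * f (Ψc V) ∂(fieldMeasure P (j + 1) G) := hIc (fun V => ρ' V * f (Ψc V))
    _ = ∫ U, ρ U * f (Ψc (avg U)) ∂(fieldMeasure P j G) := key
    _ = ∫ U, ρ U * f (avg (Ψf U)) ∂(fieldMeasure P j G) := by simp_rw [hΨavg]
    _ = ∫ U, ρ (Φf U) * f (avg (Ψf (Φf U))) ∂(fieldMeasure P j G) := (hIf (fun U => ρ U * f (avg (Ψf U)))).symm
    _ = ∫ U, ρ (Φf U) * f (avg U) ∂(fieldMeasure P j G) := by simp_rw [hΨΦf]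

end PushForward

/-! ## §2. Transport of versions along a measure-preserving continuous bijection, for a pair of a.e.-related functions -/

section Versions

variable {α : Type*} [TopologicalSpace α] [MeasurableSpace α] {μ : Measure α} {f g : α → ℝ} {Φ Ψ : α → α}

/-- A version of `f` continuous on an open `U` pulls back to a version of `g` continuous on `Φ ⁻¹' U` whenever `f ∘ Φ =ᵐ g` and `Φ` is continuous and measure
preserving. [cite: Balaban1987RG1, (0.13) p.254 and (2.17) p.269 (bookkeeping)] -/
theorem HasContVersionOn.pullback [OpensMeasurableSpace α] (hΦc : Continuous Φ) (hΦ : MeasurePreserving Φ μ μ) (hfg : f ∘ Φ =ᵐ[μ] g)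
    {U : Set α} (hU : IsOpen U) (h : HasContVersionOn μ f U) : HasContVersionOn μ g (Φ ⁻¹' U) := by
  obtain ⟨h₀, hh, hae⟩ := h
  refine ⟨h₀ ∘ Φ, hh.comp hΦc.continuousOn fun x hx => hx, ?_⟩
  have h1 : h₀ ∘ Φ =ᵐ[μ.restrict (Φ ⁻¹' U)] f ∘ Φ :=
    ((hΦ.restrict_preimage hU.measurableSet).quasiMeasurePreserving).ae_eq_comp hae
  exact h1.trans (ae_restrict_of_ae hfg)

omit [TopologicalSpace α] in
/-- The a.e. relation read through the inverse map: `f ∘ Φ =ᵐ g ⟹ g ∘ Ψ =ᵐ f`. [cite: Balaban1987RG1, (0.13) p.254 (bookkeeping)] -/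
theorem ae_eq_comp_inverse_of_ae (hΨ : MeasurePreserving Ψ μ μ) (hΦΨ : ∀ x, Φ (Ψ x) = x) (hfg : f ∘ Φ =ᵐ[μ] g) : g ∘ Ψ =ᵐ[μ] f := by
  have h1 : (f ∘ Φ) ∘ Ψ =ᵐ[μ] g ∘ Ψ := hΨ.quasiMeasurePreserving.ae_eq_comp hfg
  have h2 : (f ∘ Φ) ∘ Ψ = f := funext fun x => by simp only [Function.comp_apply, hΦΨ]
  rw [h2] at h1
  exact h1.symm

/-- **THE MAXIMAL REGULAR SETS CORRESPOND**: `regSet μ g = Φ ⁻¹' regSet μ f` for mutually inverse continuous measure-preserving `Φ`, `Ψ` with `f ∘ Φ =ᵐ g`.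
[cite: Balaban1987RG1, (0.13) p.254 and (2.17) p.269 (bookkeeping)] -/
theorem regSet_eq_preimage_of_ae [OpensMeasurableSpace α] (hΦc : Continuous Φ) (hΨc : Continuous Ψ) (hΦ : MeasurePreserving Φ μ μ)
    (hΨ : MeasurePreserving Ψ μ μ) (hΨΦ : ∀ x, Ψ (Φ x) = x) (hΦΨ : ∀ x, Φ (Ψ x) = x) (hfg : f ∘ Φ =ᵐ[μ] g) :
    regSet μ g = Φ ⁻¹' regSet μ f := by
  refine Subset.antisymm (fun x hx => ?_) (fun x hx => ?_)
  · obtain ⟨U, hU, hxU, hV⟩ := mem_regSet_iff.1 hx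
    have h1 : HasContVersionOn μ f (Ψ ⁻¹' U) := hV.pullback hΨc hΨ (ae_eq_comp_inverse_of_ae hΨ hΦΨ hfg) hU
    have h2 : Φ x ∈ Ψ ⁻¹' U := by show Ψ (Φ x) ∈ U; rw [hΨΦ]; exact hxU
    exact mem_regSet_iff.2 ⟨Ψ ⁻¹' U, hU.preimage hΨc, h2, h1⟩
  · obtain ⟨U, hU, hxU, hV⟩ := mem_regSet_iff.1 hx
    exact mem_regSet_iff.2 ⟨Φ ⁻¹' U, hU.preimage hΦc, hxU, hV.pullback hΦc hΦ hfg hU⟩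

/-- **THE CANONICAL VERSIONS CORRESPOND ON THE MAXIMAL REGULAR SET**: `canonVersion μ g = (canonVersion μ f) ∘ Φ` at every point of `regSet μ g`
(second-countable `α`, open-positive `μ`: determinacy of continuous versions on open sets).  Off the regular set both sides are the raw functions, which agree
only a.e. [cite: Balaban1987RG1, (0.13) p.254 and (2.17) p.269 (bookkeeping)] -/
theorem canonVersion_eqOn_comp_of_ae [SecondCountableTopology α] [OpensMeasurableSpace α] [μ.IsOpenPosMeasure] (hΦc : Continuous Φ) (hΨc : Continuous Ψ)
    (hΦ : MeasurePreserving Φ μ μ) (hΨ : MeasurePreserving Ψ μ μ) (hΨΦ : ∀ x, Ψ (Φ x) = x) (hΦΨ : ∀ x, Φ (Ψ x) = x) (hfg : f ∘ Φ =ᵐ[μ] g) :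
    EqOn (canonVersion μ g) (canonVersion μ f ∘ Φ) (regSet μ g) := by
  have hreg := regSet_eq_preimage_of_ae hΦc hΨc hΦ hΨ hΨΦ hΦΨ hfg
  have hmaps : MapsTo Φ (regSet μ g) (regSet μ f) := fun x hx => by
    rw [hreg] at hx
    exact hx
  have hc : ContinuousOn (canonVersion μ f ∘ Φ) (regSet μ g) := continuousOn_canonVersion.comp hΦc.continuousOn hmaps
  have hae : canonVersion μ f ∘ Φ =ᵐ[μ.restrict (regSet μ g)] g :=
    ae_restrict_of_ae ((hΦ.quasiMeasurePreserving.ae_eq_comp canonVersion_ae_eq).trans hfg)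
  exact canonVersion_eqOn_of_continuousOn isOpen_regSet hc hae

end Versions

/-! ## §3. At the record: the three generators of (2.17) -/

section Symmetries

/-- The coarse translation `τ_a` acts continuously on configurations (product topology). [cite: Balaban1987RG1, (2.17) p.269 (bookkeeping)] -/
theorem continuous_translate {P : Params} {j : ℕ} {G : Type*} [GaugeGroup G] [TopologicalSpace G] (a : Site P j) :
    Continuous (X := PBond P j → G) (Y := PBond P j → G) (GaugeField.translate a) :=
  continuous_pi fun _ => continuous_apply _

/-- The coordinate permutation `π` acts continuously on configurations. [cite: Balaban1987RG1, (2.17) p.269 (bookkeeping)] -/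
theorem continuous_permute {P : Params} {j : ℕ} {G : Type*} [GaugeGroup G] [TopologicalSpace G] (π : Equiv.Perm (Fin P.d)) :
    Continuous (X := PBond P j → G) (Y := PBond P j → G) (GaugeField.permute π) :=
  continuous_pi fun _ => continuous_apply _

variable {N : ℕ} [NeZero N]

/-- The axis reflection acts continuously on configurations (inversion on the reflected-direction bonds). [cite: Balaban1987RG1, (2.17)–(2.18) p.269 (bookkeeping)] -/
theorem continuous_reflect {P : Params} {j : ℕ} (ρ : Fin P.d) :
    Continuous (X := PBond P j → SU N) (Y := PBond P j → SU N) (GaugeField.reflect ρ) := by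
  refine continuous_pi fun b => ?_
  simp only [GaugeField.reflect_apply]
  by_cases h : b.dir = ρ
  · simp only [h, if_true]; exact (continuous_apply _).inv
  · simp only [h, if_false]; exact continuous_apply _

/-- The centre reflection `c_ρ` acts continuously on configurations. [cite: Balaban1987RG1, (2.17)–(2.18) p.269 (bookkeeping)] -/
theorem continuous_creflect {P : Params} {j : ℕ} (ρ : Fin P.d) :
    Continuous (X := PBond P j → SU N) (Y := PBond P j → SU N) (GaugeField.creflect ρ) := by
  simp only [show (GaugeField.creflect ρ : (PBond P j → SU N) → (PBond P j → SU N)) =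
    GaugeField.reflect ρ ∘ GaugeField.translate ((0 : Site P j).unshift ρ) from funext fun U => GaugeField.creflect_eq ρ U]
  exact (continuous_reflect ρ).comp (continuous_translate _)

/-- The product Haar measure is invariant under the centre reflections (translation then axis reflection). [cite: Balaban1987RG1, (2.17) p.269 (bookkeeping)] -/
theorem measurePreserving_creflect {P : Params} {j : ℕ} (ρ : Fin P.d) :
    MeasurePreserving (GaugeField.creflect (G := SU N) ρ) (fieldMeasure P j (SU N)) (fieldMeasure P j (SU N)) := by
  have h : (GaugeField.creflect ρ : GaugeField P j (SU N) → GaugeField P j (SU N)) =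
      GaugeField.reflect ρ ∘ GaugeField.translate ((0 : Site P j).unshift ρ) := funext fun U => GaugeField.creflect_eq ρ U
  rw [h]
  exact (GaugeField.measurePreserving_reflect ρ).comp (GaugeField.measurePreserving_translate _)

/-- `∫ g(c_ρ U) dU = ∫ g(U) dU`. [cite: Balaban1987RG1, (2.17) p.269 (bookkeeping)] -/
theorem integral_comp_creflect {P : Params} {j : ℕ} (ρ : Fin P.d) (g : GaugeField P j (SU N) → ℝ) :
    ∫ U, g (U.creflect ρ) ∂(fieldMeasure P j (SU N)) = ∫ U, g U ∂(fieldMeasure P j (SU N)) := by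
  simp only [GaugeField.creflect_eq]
  rw [GaugeField.integral_comp_translate ((0 : Site P j).unshift ρ) (fun U => g (U.reflect ρ)), GaugeField.integral_comp_reflect]

end Symmetries

section Record

variable {F : T4Family} {N : ℕ} [NeZero N]

open T4AveragingDisintegration (integrable_kernelTransport)

/-! ### translations -/

/-- **`T(ρ ∘ τ_{La}) = (Tρ) ∘ τ_a` ALMOST EVERYWHERE** for the one-step transport of record (`k < K`, `ρ` integrable). [cite: Balaban1987RG1, (2.17) p.269, (0.13) p.254; Balaban1985Averaging, (10) p.19] -/
theorem transportOfRecord_translate_ae {K k : ℕ} (hk : k < K) {ρ : Density (F.P K) k (SU N)} (hρ : Integrable ρ (fieldMeasure (F.P K) k (SU N)))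
    (a : Site (F.P K) (k + 1)) :
    (fun V => transportOfRecord F N K k ρ (V.translate a)) =ᵐ[fieldMeasure (F.P K) (k + 1) (SU N)]
      transportOfRecord F N K k (fun U => ρ (U.translate (Site.scale a))) := by
  have hρ' : Integrable (fun U => ρ (U.translate (Site.scale a))) (fieldMeasure (F.P K) k (SU N)) :=
    (GaugeField.measurePreserving_translate _).integrable_comp_of_integrable hρ
  have h1 : IsRT (avOfRecord F N K k).avg (fun U => ρ (U.translate (Site.scale a))) (fun V => transportOfRecord F N K k ρ (V.translate a)) :=
    isRT_comp_equivariant (isRT_transportOfRecord F N K k hk ρ hρ) (GaugeField.translate (Site.scale a)) (GaugeField.translate (Site.scale (-a)))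
      (GaugeField.translate a) (GaugeField.translate (-a)) (GaugeField.integral_comp_translate _) (GaugeField.integral_comp_translate _)
      (GaugeField.measurePreserving_translate (-a)).measurable
      (fun V => by rw [GaugeField.translate_translate, neg_add_cancel, GaugeField.translate_zero])
      (fun U => by rw [GaugeField.translate_translate, map_neg, neg_add_cancel, GaugeField.translate_zero])
      (fun U => by rw [GaugeField.translate_translate, map_neg, add_neg_cancel, GaugeField.translate_zero])
      (fun U => by rw [avOfRecord_apply]; exact BlockAveraging.blockAvg_translate _ a U)
  have h2 := isRT_transportOfRecord F N K k hk _ hρ'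
  have hi1 : Integrable (fun V => transportOfRecord F N K k ρ (V.translate a)) (fieldMeasure (F.P K) (k + 1) (SU N)) :=
    (GaugeField.measurePreserving_translate _).integrable_comp_of_integrable
      (integrable_kernelTransport (fieldMeasure (F.P K) k (SU N)) (fieldMeasure (F.P K) (k + 1) (SU N)) (avOfRecord_measurable F N K k)
        (avOfRecord_haarAC F N K k hk) hρ)
  have hi2 : Integrable (transportOfRecord F N K k fun U => ρ (U.translate (Site.scale a))) (fieldMeasure (F.P K) (k + 1) (SU N)) :=
    integrable_kernelTransport (fieldMeasure (F.P K) k (SU N)) (fieldMeasure (F.P K) (k + 1) (SU N)) (avOfRecord_measurable F N K k)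
      (avOfRecord_haarAC F N K k hk) hρ'
  exact ae_eq_of_isRT h1 h2 hi1 hi2

/-- **THE MAXIMAL REGULAR SET IS TRANSPORTED BY `τ_a`**: `regSet (T(ρ ∘ τ_{La})) = τ_a ⁻¹' regSet (Tρ)`. [cite: Balaban1987RG1, (2.17) p.269, (0.13) p.254] -/
theorem regSetOfRecord_translate {K k : ℕ} (hk : k < K) {ρ : Density (F.P K) k (SU N)} (hρ : Integrable ρ (fieldMeasure (F.P K) k (SU N)))
    (a : Site (F.P K) (k + 1)) :
    regSetOfRecord F N K k (fun U => ρ (U.translate (Site.scale a))) = GaugeField.translate a ⁻¹' regSetOfRecord F N K k ρ :=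
  regSet_eq_preimage_of_ae (μ := piHaar (F.P K) (k + 1) (SU N)) (f := fun V => transportOfRecord F N K k ρ V)
    (continuous_translate a) (continuous_translate (-a)) (GaugeField.measurePreserving_translate a) (GaugeField.measurePreserving_translate (-a))
    (fun V => by rw [GaugeField.translate_translate, neg_add_cancel, GaugeField.translate_zero])
    (fun V => by rw [GaugeField.translate_translate, add_neg_cancel, GaugeField.translate_zero])
    (transportOfRecord_translate_ae hk hρ a)

/-- **`TcanOfRecord` IS TRANSLATION COVARIANT ON THE MAXIMAL REGULAR SET**: `Tcan(ρ ∘ τ_{La})(V) = Tcan(ρ)(τ_a V)` for every `V ∈ regSet (T(ρ ∘ τ_{La}))`.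
[cite: Balaban1987RG1, (2.17) p.269, p.263, (0.13) p.254] -/
theorem TcanOfRecord_translate_of_mem_regSet {K k : ℕ} (hk : k < K) {ρ : Density (F.P K) k (SU N)} (hρ : Integrable ρ (fieldMeasure (F.P K) k (SU N)))
    (a : Site (F.P K) (k + 1)) {V : PBond (F.P K) (k + 1) → SU N} (hV : V ∈ regSetOfRecord F N K k (fun U => ρ (U.translate (Site.scale a)))) :
    TcanOfRecord F N K k (fun U => ρ (U.translate (Site.scale a))) V = TcanOfRecord F N K k ρ (GaugeField.translate a V) := by
  haveI := isOpenPosMeasure_piHaar_SUN N (F.P K) (k + 1)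
  exact canonVersion_eqOn_comp_of_ae (μ := piHaar (F.P K) (k + 1) (SU N)) (f := fun V => transportOfRecord F N K k ρ V)
    (continuous_translate a) (continuous_translate (-a)) (GaugeField.measurePreserving_translate a) (GaugeField.measurePreserving_translate (-a))
    (fun V => by rw [GaugeField.translate_translate, neg_add_cancel, GaugeField.translate_zero])
    (fun V => by rw [GaugeField.translate_translate, add_neg_cancel, GaugeField.translate_zero])
    (transportOfRecord_translate_ae hk hρ a) hV

/-! ### coordinate permutations -/

/-- **`T(ρ ∘ π) = (Tρ) ∘ π` ALMOST EVERYWHERE.** [cite: Balaban1987RG1, (2.17) p.269, (0.13) p.254; Balaban1985Averaging, (10) p.19] -/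
theorem transportOfRecord_permute_ae {K k : ℕ} (hk : k < K) {ρ : Density (F.P K) k (SU N)} (hρ : Integrable ρ (fieldMeasure (F.P K) k (SU N)))
    (π : Equiv.Perm (Fin (F.P K).d)) :
    (fun V => transportOfRecord F N K k ρ (V.permute π)) =ᵐ[fieldMeasure (F.P K) (k + 1) (SU N)]
      transportOfRecord F N K k (fun U => ρ (U.permute π)) := by
  have hρ' : Integrable (fun U => ρ (U.permute π)) (fieldMeasure (F.P K) k (SU N)) :=
    (GaugeField.measurePreserving_permute _).integrable_comp_of_integrable hρ
  have h1 : IsRT (avOfRecord F N K k).avg (fun U => ρ (U.permute π)) (fun V => transportOfRecord F N K k ρ (V.permute π)) :=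
    isRT_comp_equivariant (isRT_transportOfRecord F N K k hk ρ hρ) (GaugeField.permute π) (GaugeField.permute π⁻¹)
      (GaugeField.permute π) (GaugeField.permute π⁻¹) (GaugeField.integral_comp_permute _) (GaugeField.integral_comp_permute _)
      (GaugeField.measurePreserving_permute π⁻¹).measurable
      (fun V => by rw [GaugeField.permute_permute, mul_inv_cancel, GaugeField.permute_one])
      (fun U => by rw [GaugeField.permute_permute, mul_inv_cancel, GaugeField.permute_one])
      (fun U => by rw [GaugeField.permute_permute, inv_mul_cancel, GaugeField.permute_one])
      (fun U => by rw [avOfRecord_apply]; exact BlockAveraging.blockAvg_permute _ π U)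
  have h2 := isRT_transportOfRecord F N K k hk _ hρ'
  have hi1 : Integrable (fun V => transportOfRecord F N K k ρ (V.permute π)) (fieldMeasure (F.P K) (k + 1) (SU N)) :=
    (GaugeField.measurePreserving_permute _).integrable_comp_of_integrable
      (integrable_kernelTransport (fieldMeasure (F.P K) k (SU N)) (fieldMeasure (F.P K) (k + 1) (SU N)) (avOfRecord_measurable F N K k)
        (avOfRecord_haarAC F N K k hk) hρ)
  have hi2 : Integrable (transportOfRecord F N K k fun U => ρ (U.permute π)) (fieldMeasure (F.P K) (k + 1) (SU N)) :=
    integrable_kernelTransport (fieldMeasure (F.P K) k (SU N)) (fieldMeasure (F.P K) (k + 1) (SU N)) (avOfRecord_measurable F N K k)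
      (avOfRecord_haarAC F N K k hk) hρ'
  exact ae_eq_of_isRT h1 h2 hi1 hi2

/-- **THE MAXIMAL REGULAR SET IS TRANSPORTED BY `π`.** [cite: Balaban1987RG1, (2.17) p.269, (0.13) p.254] -/
theorem regSetOfRecord_permute {K k : ℕ} (hk : k < K) {ρ : Density (F.P K) k (SU N)} (hρ : Integrable ρ (fieldMeasure (F.P K) k (SU N)))
    (π : Equiv.Perm (Fin (F.P K).d)) :
    regSetOfRecord F N K k (fun U => ρ (U.permute π)) = GaugeField.permute π ⁻¹' regSetOfRecord F N K k ρ :=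
  regSet_eq_preimage_of_ae (μ := piHaar (F.P K) (k + 1) (SU N)) (f := fun V => transportOfRecord F N K k ρ V)
    (continuous_permute π) (continuous_permute π⁻¹) (GaugeField.measurePreserving_permute π) (GaugeField.measurePreserving_permute π⁻¹)
    (fun V => by rw [GaugeField.permute_permute, mul_inv_cancel, GaugeField.permute_one])
    (fun V => by rw [GaugeField.permute_permute, inv_mul_cancel, GaugeField.permute_one])
    (transportOfRecord_permute_ae hk hρ π)

/-- **`TcanOfRecord` IS PERMUTATION COVARIANT ON THE MAXIMAL REGULAR SET.** [cite: Balaban1987RG1, (2.17) p.269, p.263, (0.13) p.254] -/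
theorem TcanOfRecord_permute_of_mem_regSet {K k : ℕ} (hk : k < K) {ρ : Density (F.P K) k (SU N)} (hρ : Integrable ρ (fieldMeasure (F.P K) k (SU N)))
    (π : Equiv.Perm (Fin (F.P K).d)) {V : PBond (F.P K) (k + 1) → SU N} (hV : V ∈ regSetOfRecord F N K k (fun U => ρ (U.permute π))) :
    TcanOfRecord F N K k (fun U => ρ (U.permute π)) V = TcanOfRecord F N K k ρ (GaugeField.permute π V) := by
  haveI := isOpenPosMeasure_piHaar_SUN N (F.P K) (k + 1)
  exact canonVersion_eqOn_comp_of_ae (μ := piHaar (F.P K) (k + 1) (SU N)) (f := fun V => transportOfRecord F N K k ρ V)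
    (continuous_permute π) (continuous_permute π⁻¹) (GaugeField.measurePreserving_permute π) (GaugeField.measurePreserving_permute π⁻¹)
    (fun V => by rw [GaugeField.permute_permute, mul_inv_cancel, GaugeField.permute_one])
    (fun V => by rw [GaugeField.permute_permute, inv_mul_cancel, GaugeField.permute_one])
    (transportOfRecord_permute_ae hk hρ π) hV

/-! ### centre reflections -/

/-- **`T(ρ ∘ c_ρ) = (Tρ) ∘ c_ρ` ALMOST EVERYWHERE** (the centre reflection is an involution on both tori and intertwines the block averaging:
`BlockAveraging.blockAvg_creflect`). [cite: Balaban1987RG1, (2.17)–(2.18) p.269, (0.13) p.254; Balaban1985Averaging, (10) p.19] -/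
theorem transportOfRecord_creflect_ae {K k : ℕ} (hk : k < K) {ρ : Density (F.P K) k (SU N)} (hρ : Integrable ρ (fieldMeasure (F.P K) k (SU N)))
    (r : Fin (F.P K).d) :
    (fun V => transportOfRecord F N K k ρ (V.creflect r)) =ᵐ[fieldMeasure (F.P K) (k + 1) (SU N)]
      transportOfRecord F N K k (fun U => ρ (U.creflect r)) := by
  have hρ' : Integrable (fun U => ρ (U.creflect r)) (fieldMeasure (F.P K) k (SU N)) :=
    (measurePreserving_creflect _).integrable_comp_of_integrable hρ
  have h1 : IsRT (avOfRecord F N K k).avg (fun U => ρ (U.creflect r)) (fun V => transportOfRecord F N K k ρ (V.creflect r)) :=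
    isRT_comp_equivariant (isRT_transportOfRecord F N K k hk ρ hρ) (GaugeField.creflect r) (GaugeField.creflect r)
      (GaugeField.creflect r) (GaugeField.creflect r) (integral_comp_creflect _) (integral_comp_creflect _)
      (measurePreserving_creflect _).measurable
      (fun V => B12EuclClause263.creflect_creflect r V) (fun U => B12EuclClause263.creflect_creflect r U) (fun U => B12EuclClause263.creflect_creflect r U)
      (fun U => by rw [avOfRecord_apply]; exact BlockAveraging.blockAvg_creflect _ r U)
  have h2 := isRT_transportOfRecord F N K k hk _ hρ'
  have hi1 : Integrable (fun V => transportOfRecord F N K k ρ (V.creflect r)) (fieldMeasure (F.P K) (k + 1) (SU N)) :=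
    (measurePreserving_creflect _).integrable_comp_of_integrable
      (integrable_kernelTransport (fieldMeasure (F.P K) k (SU N)) (fieldMeasure (F.P K) (k + 1) (SU N)) (avOfRecord_measurable F N K k)
        (avOfRecord_haarAC F N K k hk) hρ)
  have hi2 : Integrable (transportOfRecord F N K k fun U => ρ (U.creflect r)) (fieldMeasure (F.P K) (k + 1) (SU N)) :=
    integrable_kernelTransport (fieldMeasure (F.P K) k (SU N)) (fieldMeasure (F.P K) (k + 1) (SU N)) (avOfRecord_measurable F N K k)
      (avOfRecord_haarAC F N K k hk) hρ'
  exact ae_eq_of_isRT h1 h2 hi1 hi2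

/-- **THE MAXIMAL REGULAR SET IS TRANSPORTED BY `c_ρ`.** [cite: Balaban1987RG1, (2.17) p.269, (0.13) p.254] -/
theorem regSetOfRecord_creflect {K k : ℕ} (hk : k < K) {ρ : Density (F.P K) k (SU N)} (hρ : Integrable ρ (fieldMeasure (F.P K) k (SU N)))
    (r : Fin (F.P K).d) :
    regSetOfRecord F N K k (fun U => ρ (U.creflect r)) = GaugeField.creflect r ⁻¹' regSetOfRecord F N K k ρ :=
  regSet_eq_preimage_of_ae (μ := piHaar (F.P K) (k + 1) (SU N)) (f := fun V => transportOfRecord F N K k ρ V)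
    (continuous_creflect r) (continuous_creflect r) (measurePreserving_creflect r) (measurePreserving_creflect r)
    (fun V => B12EuclClause263.creflect_creflect r V) (fun V => B12EuclClause263.creflect_creflect r V)
    (transportOfRecord_creflect_ae hk hρ r)

/-- **`TcanOfRecord` IS COVARIANT UNDER THE CENTRE REFLECTIONS ON THE MAXIMAL REGULAR SET.** [cite: Balaban1987RG1, (2.17) p.269, p.263, (0.13) p.254] -/
theorem TcanOfRecord_creflect_of_mem_regSet {K k : ℕ} (hk : k < K) {ρ : Density (F.P K) k (SU N)} (hρ : Integrable ρ (fieldMeasure (F.P K) k (SU N)))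
    (r : Fin (F.P K).d) {V : PBond (F.P K) (k + 1) → SU N} (hV : V ∈ regSetOfRecord F N K k (fun U => ρ (U.creflect r))) :
    TcanOfRecord F N K k (fun U => ρ (U.creflect r)) V = TcanOfRecord F N K k ρ (GaugeField.creflect r V) := by
  haveI := isOpenPosMeasure_piHaar_SUN N (F.P K) (k + 1)
  exact canonVersion_eqOn_comp_of_ae (μ := piHaar (F.P K) (k + 1) (SU N)) (f := fun V => transportOfRecord F N K k ρ V)
    (continuous_creflect r) (continuous_creflect r) (measurePreserving_creflect r) (measurePreserving_creflect r)
    (fun V => B12EuclClause263.creflect_creflect r V) (fun V => B12EuclClause263.creflect_creflect r V)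
    (transportOfRecord_creflect_ae hk hρ r) hV

end Record

end Literature.MathematicalPhysics.QuantumFieldTheory.Balaban1983to89.Node00

end
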